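import Literature.Barriers.RiemannHypothesis.EpsteinZetaRealZerosSmallK
import Literature.Barriers.RiemannHypothesis.EpsteinZetaRealZeroLocated
import Literature.Barriers.Parity.SiegelZeroDichotomy
import HarnessLib

/-!
# Goldfeld–Schinzel's Corollary for odd characters in the kernel: no real zero of `L(s, χ_{−d})` in
# `[1 − c/√d, 1)` for every `c < 6/π` (`d ≥ d₀(c)` explicit); `1 − β > 1.5/√d` for `d ≥ 441`,
# `1 − β > 1.9/√d` for `d ≥ 2.2·10⁶`

Topic `Literature/NumberTheory/LFunctions` (namespace `Literature.NumberTheory.LFunctions`, sub-namespace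
`ClassSumRepulsion`). Everything in this file is PROVED (theorems only; no definition, no named fact, debt 0).
Cell `parity-realchar` (SIEGEL INSTRUMENT): TARGET §2 row 16 (universal effective repulsion of real zeros), ODD
column — the class-ISOLATED sign argument of `Literature/Barriers/RiemannHypothesis/EpsteinZetaRealZerosNearOne.lean`
(`LFunction_re_pos_of_odd_quadratic`: `Re L(σ, χ) > 0` on `[1 − 2/(5√d), 1)`) rerun with sharp bounds for the
completed Riemann zeta function, reaching Goldfeld–Schinzel's printed constant `6/π` in the limit.

## The argument

`χ` odd real primitive mod `d > 4`; `ζ(s)L(s, χ) = ½Σ_{Q reduced} Z_Q(s)` continued to `ℂ ∖ {1}` (tree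
`riemannZeta_mul_LFunction_eq_half_sum_of_one_lt_re`), `Z_Q(σ) = c_d(σ)Λ_{z_Q}(σ)` with `c_d(σ) > 0` and
`y_Q = Im z_Q = √d/(2a) ≥ √3/2` (`continuation_ofReal_eq`, `exists_zQ'`). At `σ = 1 − δ`, `0 < δ ≤ 1/10`:

* classes with `y ≥ 1` (`re_thetaΛ_lt_of_one_le_im`): `Λ_z(σ) = 2y^σΛ(2σ) + 2y^{1−σ}Λ(2−2σ) + E_z(σ)` (tree
  `Λ_eq_constantTerm_add_besselPart`) with
  - `0 ≤ Λ(2−2δ) ≤ π/6 + 2.6δ` — the CHORD bound `Λ₀(u) ≤ (2−u)Λ₀(1) + (u−1)Λ₀(2)` on `[1, 2]`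
    (`re_completedRiemannZeta₀_le_chord`: convexity of `u ↦ t^{u/2−1}` under the non-negative theta kernel),
    `Λ₀(1) < 0.0234` (tree), `Λ₀(2) = π/6 − ½` (tree), `1/(1−2δ) ≤ 1 + 2.5δ`;
  - `Λ(2δ) < 1/20 − 1/(2δ) − 1/(1−2δ) < −1/(2δ) − 0.95` (tree `re_completedRiemannZeta_one_sub_lt`), `y^δ ≥ 1`;
  - `|E_z(σ)| ≤ 48√y e^{−1.4πy} ≤ 48/49`;
  hence **`Re Λ_z(1 − δ) < 2y(π/6 + 2.6δ) − 1/δ − 0.92`**;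
* classes with `√3/2 ≤ y ≤ 1`: `Re Λ_z(σ) < 0` on all of `(0, 1)` (tree `re_thetaΛ_neg_of_im_le_one`).

Since `2y_Q ≤ √d` (`a ≥ 1`), EVERY class is negative at `σ = 1 − δ` as soon as
`√d(π/6 + 2.6δ) ≤ 1/δ + 0.92`; with `δ ≤ c/√d` this follows from **`√d(1/c − π/6) ≥ 2.6c − 0.92`** (and
`√d ≥ 10c` for `δ ≤ 1/10`). Then `ζ(σ)L(σ, χ) = ½ΣZ_Q(σ) < 0` and `ζ(σ) < 0` give `L(σ, χ) > 0`:

* `LFunction_re_pos_of_odd_quadratic_sharp` — **for `0 < c`, `√d ≥ 10c`, `√d(1/c − π/6) ≥ 2.6c − 0.92`: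
  `Re L(σ, χ) > 0` for `1 − c/√d ≤ σ < 1`** (so no real zero there: `LFunction_ne_zero_of_odd_quadratic_sharp`);
* numeric instances: `one_sub_realZero_gt_three_halves_of_odd` **`1 − β > 1.5/√d` for every real zero `β < 1`,
  all odd primitive quadratic `χ` mod `d ≥ 441`**; `one_sub_realZero_gt_of_odd_of_ge` **`1 − β > 1.9/√d` for
  `d ≥ 2.2·10⁶`**; on the column's predicate `isSiegelZero_quality_lt_of_odd`: **quality `η < √d/(1.5 log d)`**
  (`d ≥ 441`; row 16 had `η ≤ (3/2)√q log q`);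
* `goldfeldSchinzel1975_corollary_odd` — **the ODD half of Goldfeld–Schinzel's Corollary AS PRINTED: for every
  `η > 0` there is an (explicit) `c(η)` with `1 − β ≥ (6/π − η)/√d` for all `d > c(η)`, every odd primitive
  quadratic `χ` mod `d` and every real zero `β`** — our own proof of the cited statement (the typed named fact
  `goldfeldSchinzel1975_corollary` of `SiegelZeroFormSumAsymptotic.lean` conjoins it with the even case
  `(6/π² − η) log d/√d`, which the Epstein route does not reach: indefinite forms).

Comparators (TARGET row 16): tree kernel before this file — `2/(3√q log²q)` both parities (rc-cond g7),
`2/(5√d)` odd (NearOne, 2026-08-17); print — Goldfeld–Schinzel 1975 Cor. `(6/π − η)/√|d|` (ineffective-looking but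
effective `c(η)`; here `c(η)` explicit), Ralaivaosaona–Razakarinoro 2026 Thm 1 `6.035/√d` (`d > 3·10⁸`, print
frontier, ≈ `π` times better than `6/π`).

LABEL (cell rule): TARGET row 16 ODD column, kernel, hypothesis-free. WHAT THIS IS NOT: nothing for even characters;
not a Siegel-type bound (`1/√d`, not `1/log d`); nothing here bears on parity (H5).

## References (context; `goldfeldSchinzel1975_corollary_odd` is our proof of the cited printed statement)

* [GoldfeldSchinzel1975] D. M. Goldfeld, A. Schinzel, *On Siegel's zero*, Ann. Sc. Norm. Super. Pisa (4) 2 (1975)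
  571–583, Corollary p. 572 (case `d < 0`).
* [BatemanGrosswald1964] Theorems 1–2 (constant term, Bessel part).
* [MontgomeryVaughan2007] §10.1 Exercise 25; Corollary 11.12 and §11.5 notes.
* [RalaivaosaonaRazakarinoro2026] Theorem 1 (print frontier, context).
-/

noncomputable section

open Complex Filter Topology MeasureTheory Set HurwitzZeta
open scoped UpperHalfPlane
open Literature.Barriers.RiemannHypothesis
open Literature.Barriers.Parity
open Literature.NumberTheory.Automorphic
open Literature.NumberTheory.LFunctions.RealZeros
open Literature.NumberTheory.QuadraticFields Literature.NumberTheory.QuadraticFields.Quadratic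
open Literature.NumberTheory.QuadraticFields.BinaryQuadraticForm (reducedForms mem_reducedForms_iff
  le_of_isReduced discr_apply)

namespace Literature.NumberTheory.LFunctions

namespace ClassSumRepulsion

/-! ### The chord bound for `Λ₀` on `[1, 2]` -/

/-- **Chord bound: `Re Λ₀(u) ≤ (2 − u) Re Λ₀(1) + (u − 1) Re Λ₀(2)` for `1 ≤ u ≤ 2`** — convexity of
`u ↦ t^{u/2−1} = e^{(u/2−1) log t}` under the non-negative kernel of `Λ₀(u) = ½∫₀^∞ t^{u/2−1}k(t)dt`
(tree `RealZeros.re_completedRiemannZeta₀_ofReal`). [folklore] -/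
private theorem re_completedRiemannZeta₀_le_chord {u : ℝ} (h1 : 1 ≤ u) (h2 : u ≤ 2) :
    (completedRiemannZeta₀ u).re ≤
      (2 - u) * (completedRiemannZeta₀ (1 : ℝ)).re + (u - 1) * (completedRiemannZeta₀ (2 : ℝ)).re := by
  rw [re_completedRiemannZeta₀_ofReal, re_completedRiemannZeta₀_ofReal, re_completedRiemannZeta₀_ofReal,
    show (2 - u) * ((∫ t in Ioi (0 : ℝ), t ^ ((1 : ℝ) / 2 - 1) * kernel t) / 2) +
        (u - 1) * ((∫ t in Ioi (0 : ℝ), t ^ ((2 : ℝ) / 2 - 1) * kernel t) / 2) =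
      ((2 - u) * (∫ t in Ioi (0 : ℝ), t ^ ((1 : ℝ) / 2 - 1) * kernel t) +
        (u - 1) * (∫ t in Ioi (0 : ℝ), t ^ ((2 : ℝ) / 2 - 1) * kernel t)) / 2 by ring,
    ← integral_const_mul, ← integral_const_mul,
    ← integral_add ((integrableOn_kernel 1).const_mul _) ((integrableOn_kernel 2).const_mul _)]
  refine div_le_div_of_nonneg_right ?_ (by norm_num)
  refine setIntegral_mono_on (integrableOn_kernel u)
    (((integrableOn_kernel 1).const_mul _).add ((integrableOn_kernel 2).const_mul _)) measurableSet_Ioi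
    (fun t ht ↦ ?_)
  have ht : (0 : ℝ) < t := ht
  rw [← mul_assoc, ← mul_assoc, ← add_mul]
  refine mul_le_mul_of_nonneg_right ?_ (kernel_nonneg t)
  -- convexity of `p ↦ t^p = exp(p log t)` at the weights `2 − u`, `u − 1`
  have hconv := (convexOn_exp).2 (Set.mem_univ ((1 / 2 - 1 : ℝ) * Real.log t))
    (Set.mem_univ ((2 / 2 - 1 : ℝ) * Real.log t)) (by linarith : (0 : ℝ) ≤ 2 - u)
    (by linarith : (0 : ℝ) ≤ u - 1) (by ring : (2 - u) + (u - 1) = (1 : ℝ))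
  simp only [smul_eq_mul] at hconv
  rw [Real.rpow_def_of_pos ht, Real.rpow_def_of_pos ht, Real.rpow_def_of_pos ht]
  have e : Real.log t * (u / 2 - 1) =
      (2 - u) * ((1 / 2 - 1 : ℝ) * Real.log t) + (u - 1) * ((2 / 2 - 1 : ℝ) * Real.log t) := by ring
  rw [e, show Real.log t * ((1 : ℝ) / 2 - 1) = (1 / 2 - 1 : ℝ) * Real.log t by ring,
    show Real.log t * ((2 : ℝ) / 2 - 1) = (2 / 2 - 1 : ℝ) * Real.log t by ring]
  exact hconv

/-- **`0 ≤ Re Λ(2 − 2δ) ≤ π/6 + 2.6δ`** for `0 < δ ≤ 1/10`: the chord bound with `Λ₀(1) < 0.0234`,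
`Λ₀(2) = π/6 − ½` (tree), and `Λ = Λ₀ − 1/u − 1/(1−u)` at `u = 2 − 2δ` (`−1/(2−2δ) ≤ −½`,
`1/(1−2δ) ≤ 1 + 2.5δ`); non-negativity from `Λ₀ ≥ 0`. [folklore] -/
private theorem re_Λ_two_sub {δ : ℝ} (hδ0 : 0 < δ) (hδ1 : δ ≤ 1 / 10) :
    0 ≤ (completedRiemannZeta ((2 - 2 * δ : ℝ) : ℂ)).re ∧
      (completedRiemannZeta ((2 - 2 * δ : ℝ) : ℂ)).re ≤ Real.pi / 6 + 2.6 * δ := by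
  have hlow := re_completedRiemannZeta_ge_of_one_lt (u := 2 - 2 * δ) (by linarith)
  constructor
  · refine le_trans ?_ hlow
    have h1 : 1 / (2 - 2 * δ) ≤ 1 / (2 - 2 * δ - 1) :=
      one_div_le_one_div_of_le (by linarith) (by linarith)
    linarith
  · rw [completedRiemannZeta_eq]
    have hch := re_completedRiemannZeta₀_le_chord (u := 2 - 2 * δ) (by linarith) (by linarith)
    have hA := re_completedRiemannZeta₀_one_lt_sharp
    have hB : (completedRiemannZeta₀ (2 : ℝ)).re = Real.pi / 6 - 1 / 2 := by
      rw [Complex.ofReal_ofNat, completedRiemannZeta₀_two]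
      rw [← Complex.ofReal_ofNat 6, ← Complex.ofReal_div, ← Complex.ofReal_one,
        ← Complex.ofReal_ofNat 2, ← Complex.ofReal_div, ← Complex.ofReal_sub, Complex.ofReal_re]
    have hσ : (1 / ((2 - 2 * δ : ℝ) : ℂ)).re = 1 / (2 - 2 * δ) := by
      rw [← Complex.ofReal_one, ← Complex.ofReal_div, Complex.ofReal_re]
    have hσ' : (1 / (1 - ((2 - 2 * δ : ℝ) : ℂ))).re = -(1 / (1 - 2 * δ)) := by
      rw [← Complex.ofReal_one, ← Complex.ofReal_sub, ← Complex.ofReal_div, Complex.ofReal_re]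
      rw [show (1 : ℝ) - (2 - 2 * δ) = -(1 - 2 * δ) by ring, div_neg]
    simp only [sub_re, hσ, hσ']
    -- numeric pieces
    have hpi0 : 0 ≤ Real.pi / 6 - 1 / 2 := by linarith [Real.pi_gt_three]
    have hw1 : (0 : ℝ) ≤ 2 - (2 - 2 * δ) := by linarith
    have hch' : (completedRiemannZeta₀ ((2 - 2 * δ : ℝ) : ℂ)).re ≤
        2 * δ * 0.0234 + (Real.pi / 6 - 1 / 2) := by
      rw [hB] at hch
      have e1 : (2 : ℝ) - (2 - 2 * δ) = 2 * δ := by ring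
      have e2 : (2 - 2 * δ : ℝ) - 1 = 1 - 2 * δ := by ring
      rw [e1, e2] at hch
      have h12 : (1 - 2 * δ) * (Real.pi / 6 - 1 / 2) ≤ Real.pi / 6 - 1 / 2 := by nlinarith
      nlinarith
    have hinv1 : 1 / 2 ≤ 1 / (2 - 2 * δ) := one_div_le_one_div_of_le (by linarith) (by linarith)
    have hinv2 : 1 / (1 - 2 * δ) ≤ 1 + 2.5 * δ := by
      rw [div_le_iff₀ (by linarith)]; nlinarith
    linarith

/-- **`Re Λ(2δ) < −1/(2δ) − 0.95`** for `0 < δ ≤ 1/10` (tree `re_completedRiemannZeta_one_sub_lt`: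
`Λ(1 − u) < 1/20 − 1/(1−u) − 1/u` with `u = 1 − 2δ`, and `1/(1−2δ) > 1`). [folklore] -/
private theorem re_Λ_small {δ : ℝ} (hδ0 : 0 < δ) (hδ1 : δ ≤ 1 / 10) :
    (completedRiemannZeta ((2 * δ : ℝ) : ℂ)).re < -(1 / (2 * δ)) - 0.95 := by
  have h := re_completedRiemannZeta_one_sub_lt (u := 1 - 2 * δ) (by linarith) (by linarith)
  rw [show (1 : ℝ) - (1 - 2 * δ) = 2 * δ by ring] at h
  have h1 : 1 < 1 / (1 - 2 * δ) := by rw [lt_div_iff₀ (by linarith)]; linarith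
  linarith

/-- `48 √y e^{−(7/5)πy} ≤ 48/49` for `y ≥ 1` (`e^{(7/5)πy} ≥ e^{4y} ≥ 49y`, `√y ≤ y`). [folklore] -/
private theorem besselBound_le {y : ℝ} (hy : 1 ≤ y) :
    48 * Real.sqrt y * Real.exp (-(7 / 5) * Real.pi * y) ≤ 48 / 49 := by
  have hy0 : 0 < y := by linarith
  have he := Real.exp_one_gt_d9
  have h2 : (7 : ℝ) < Real.exp 2 := by
    rw [show (2 : ℝ) = 1 + 1 by norm_num, Real.exp_add]; nlinarith
  have h4 : (49 : ℝ) < Real.exp 4 := by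
    rw [show (4 : ℝ) = 2 + 2 by norm_num, Real.exp_add]; nlinarith [Real.exp_pos 2]
  have hexp : 49 * y ≤ Real.exp (4 * y) := by
    rw [show 4 * y = 4 + 4 * (y - 1) by ring, Real.exp_add]
    have h1 : 1 + 4 * (y - 1) ≤ Real.exp (4 * (y - 1)) := by
      have := Real.add_one_le_exp (4 * (y - 1)); linarith
    calc 49 * y ≤ 49 * (1 + 4 * (y - 1)) := by nlinarith
      _ ≤ Real.exp 4 * Real.exp (4 * (y - 1)) := by
          nlinarith [Real.exp_pos (4 * (y - 1)), Real.exp_pos (4 : ℝ)]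
  have hle : Real.exp (-(7 / 5) * Real.pi * y) ≤ Real.exp (-(4 * y)) :=
    Real.exp_le_exp.2 (by nlinarith [Real.pi_gt_three])
  rw [Real.exp_neg] at hle
  have hsq : Real.sqrt y ≤ y := by rw [Real.sqrt_le_left hy0.le]; nlinarith
  have hinv : (Real.exp (4 * y))⁻¹ ≤ 1 / (49 * y) := by
    rw [inv_eq_one_div]; exact one_div_le_one_div_of_le (by positivity) hexp
  have hE := Real.exp_pos (-(7 / 5) * Real.pi * y)
  calc 48 * Real.sqrt y * Real.exp (-(7 / 5) * Real.pi * y)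
      ≤ 48 * y * Real.exp (-(7 / 5) * Real.pi * y) := by nlinarith
    _ ≤ 48 * y * (1 / (49 * y)) := mul_le_mul_of_nonneg_left (hle.trans hinv) (by positivity)
    _ = 48 / 49 := by field_simp

/-! ### The sharp per-class bound left of `s = 1` -/

/-- **Classes with `y = Im z ≥ 1`, just left of `s = 1`**: for `0 < δ ≤ 1/10`,
`Re Λ_z(1 − δ) < 2y(π/6 + 2.6δ) − 1/δ − 0.92` (constant-term decomposition with the chord bound for `Λ(2−2δ)`,
`Λ(2δ) < −1/(2δ) − 0.95`, `|E_z| ≤ 48/49`). [cite: BatemanGrosswald1964, Theorem 1 (3)–(5) and Theorem 2 (8)] -/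
theorem re_thetaΛ_lt_of_one_le_im (z : ℍ) (hy : 1 ≤ z.im) {δ : ℝ} (hδ0 : 0 < δ) (hδ1 : δ ≤ 1 / 10) :
    ((thetaFEPair z).Λ ((1 - δ : ℝ) : ℂ)).re <
      2 * z.im * (Real.pi / 6 + 2.6 * δ) - 1 / δ - 0.92 := by
  set y := z.im with hydef
  have hy0 : 0 < y := by linarith
  set σ : ℝ := 1 - δ with hσdef
  have hσ0 : (0 : ℝ) < σ := by rw [hσdef]; linarith
  have hσ1 : σ < 1 := by rw [hσdef]; linarith
  -- the decomposition at `s = σ`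
  have h0 : (σ : ℂ) ≠ 0 := by exact_mod_cast hσ0.ne'
  have h1 : (σ : ℂ) ≠ 1 := by exact_mod_cast hσ1.ne
  have hh : (σ : ℂ) ≠ 1 / 2 := by
    intro h
    have := congrArg Complex.re h
    simp at this
    rw [hσdef] at this
    linarith
  have hdec := Λ_eq_constantTerm_add_besselPart z hy h0 h1 hh
  have eA : (2 * ((y : ℝ) : ℂ) ^ (σ : ℂ) * completedRiemannZeta (2 * (σ : ℂ))).re =
      2 * y ^ σ * (completedRiemannZeta ((2 * σ : ℝ) : ℂ)).re := by
    rw [show (2 : ℂ) * (σ : ℂ) = ((2 * σ : ℝ) : ℂ) by push_cast; ring, ← Complex.ofReal_cpow hy0.le,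
      show (2 : ℂ) * ((y ^ σ : ℝ) : ℂ) = ((2 * y ^ σ : ℝ) : ℂ) by push_cast; ring,
      Complex.re_ofReal_mul]
  have eB : (2 * ((y : ℝ) : ℂ) ^ (1 - (σ : ℂ)) * completedRiemannZeta (2 - 2 * (σ : ℂ))).re =
      2 * y ^ (1 - σ) * (completedRiemannZeta ((2 - 2 * σ : ℝ) : ℂ)).re := by
    rw [show (2 : ℂ) - 2 * (σ : ℂ) = ((2 - 2 * σ : ℝ) : ℂ) by push_cast; ring,
      show (1 : ℂ) - (σ : ℂ) = ((1 - σ : ℝ) : ℂ) by push_cast; ring, ← Complex.ofReal_cpow hy0.le,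
      show (2 : ℂ) * ((y ^ (1 - σ) : ℝ) : ℂ) = ((2 * y ^ (1 - σ) : ℝ) : ℂ) by push_cast; ring,
      Complex.re_ofReal_mul]
  -- the two `Λ`-values
  have e2σ : (2 * σ : ℝ) = 2 - 2 * δ := by rw [hσdef]; ring
  have e2σ' : (2 - 2 * σ : ℝ) = 2 * δ := by rw [hσdef]; ring
  obtain ⟨hL2pos, hL2⟩ := re_Λ_two_sub hδ0 hδ1
  rw [← e2σ] at hL2pos hL2
  have hL0 : (completedRiemannZeta ((2 - 2 * σ : ℝ) : ℂ)).re < -(1 / (2 * δ)) - 0.95 := by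
    rw [e2σ']; exact re_Λ_small hδ0 hδ1
  -- bounds for the three terms
  have hpowA : 0 < y ^ σ := Real.rpow_pos_of_pos hy0 σ
  have hpowA' : y ^ σ ≤ y := by
    calc y ^ σ ≤ y ^ (1 : ℝ) := Real.rpow_le_rpow_of_exponent_le hy hσ1.le
      _ = y := Real.rpow_one y
  have hA : 2 * y ^ σ * (completedRiemannZeta ((2 * σ : ℝ) : ℂ)).re ≤ 2 * y * (Real.pi / 6 + 2.6 * δ) := by
    calc 2 * y ^ σ * (completedRiemannZeta ((2 * σ : ℝ) : ℂ)).re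
        ≤ 2 * y ^ σ * (Real.pi / 6 + 2.6 * δ) := mul_le_mul_of_nonneg_left hL2 (by positivity)
      _ ≤ 2 * y * (Real.pi / 6 + 2.6 * δ) := by
          apply mul_le_mul_of_nonneg_right _ (by linarith [Real.pi_gt_three])
          linarith
  have hpowB : 1 ≤ y ^ (1 - σ) := by
    calc (1 : ℝ) = 1 ^ (1 - σ) := (Real.one_rpow _).symm
      _ ≤ y ^ (1 - σ) := Real.rpow_le_rpow zero_le_one hy (by linarith)
  have hB : 2 * y ^ (1 - σ) * (completedRiemannZeta ((2 - 2 * σ : ℝ) : ℂ)).re < -(1 / δ) - 1.9 := by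
    have hneg : (completedRiemannZeta ((2 - 2 * σ : ℝ) : ℂ)).re < 0 := by
      have : 0 < 1 / (2 * δ) := by positivity
      linarith
    have h12 : 1 / (2 * δ) = (1 / δ) / 2 := by field_simp
    calc 2 * y ^ (1 - σ) * (completedRiemannZeta ((2 - 2 * σ : ℝ) : ℂ)).re
        ≤ 2 * 1 * (completedRiemannZeta ((2 - 2 * σ : ℝ) : ℂ)).re := by nlinarith
      _ < 2 * 1 * (-(1 / (2 * δ)) - 0.95) := by nlinarith
      _ = -(1 / δ) - 1.9 := by rw [h12]; ring
  have hC : (epsteinBesselPart z σ).re ≤ 48 / 49 := by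
    have hn := norm_epsteinBesselPart_le z hy (s := (σ : ℂ)) (by simp; linarith) (by simp; linarith)
    exact (Complex.re_le_norm _).trans (hn.trans (besselBound_le hy))
  have hσc : ((1 - δ : ℝ) : ℂ) = (σ : ℂ) := by rw [hσdef]
  rw [hσc, hdec, Complex.add_re, Complex.add_re, eA, eB]
  norm_num at hA hB hC ⊢
  linarith

/-! ### Every class is negative on `[1 − c/√d, 1)` -/

variable {a b c : ℝ}

/-- **A reduced class just left of `s = 1`, sharp form.** For a reduced form `(a, b, c)` of discriminant `−d`
(`d > 4`), any continuation `Z` of `ζ_Q`, and `σ = 1 − δ` with `0 < δ ≤ 1/10` and `√d(π/6 + 2.6δ) ≤ 1/δ + 0.92`: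
`Re Z(σ) < 0` (classes with `k = √d/(2a) ≥ 1` by `re_thetaΛ_lt_of_one_le_im` and `2k ≤ √d`; round classes
`√3/2 ≤ k ≤ 1` by the tree's `re_neg_of_starkK_le_one`). [cite: MontgomeryVaughan2007, Corollary 11.12 and §11.5 notes] -/
theorem re_neg_of_mem_reducedForms_sharp {d : ℕ} (hd : 4 < d) {A B C : ℤ}
    (hQ : (A, B, C) ∈ reducedForms (-(d : ℤ))) {Z : ℂ → ℂ}
    (hZ : IsEpsteinContinuation (A : ℝ) (B : ℝ) (C : ℝ) Z) {δ : ℝ} (hδ0 : 0 < δ) (hδ1 : δ ≤ 1 / 10)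
    (hX : Real.sqrt d * (Real.pi / 6 + 2.6 * δ) ≤ 1 / δ + 0.92) :
    (Z ((1 - δ : ℝ) : ℂ)).re < 0 := by
  have hD0 : (-(d : ℤ)) < 0 := by omega
  obtain ⟨hdisc, ha, -, hred⟩ := (mem_reducedForms_iff hD0).1 hQ
  obtain ⟨-, hb1, hb2, hac⟩ := le_of_isReduced hdisc ha hred
  simp only at ha
  rw [discr_apply] at hdisc
  have hbsq : B ^ 2 ≤ A ^ 2 := by nlinarith
  have h3a : 3 * A ^ 2 ≤ (d : ℤ) := by nlinarith
  have haR : (1 : ℝ) ≤ A := by exact_mod_cast ha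
  have hdR : (4 : ℝ) * A * C - (B : ℝ) ^ 2 = d := by exact_mod_cast (by linarith : 4 * A * C - B ^ 2 = (d : ℤ))
  have h3aR : 3 * (A : ℝ) ^ 2 ≤ d := by exact_mod_cast h3a
  have hd4R : (4 : ℝ) < d := by exact_mod_cast hd
  have hpos : IsPosDefForm (A : ℝ) (B : ℝ) (C : ℝ) := ⟨by linarith, by linarith⟩
  have hk : starkK (A : ℝ) (B : ℝ) (C : ℝ) = Real.sqrt d / (2 * A) := by rw [starkK, hdR]
  have hsd : 2 ≤ Real.sqrt d := (Real.le_sqrt' two_pos).2 (by linarith)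
  have hsd0 : 0 < Real.sqrt d := by linarith
  have hk45 : 4 / 5 ≤ starkK (A : ℝ) (B : ℝ) (C : ℝ) := by
    rw [hk, le_div_iff₀ (by positivity), Real.le_sqrt' (by positivity)]
    nlinarith
  have hσ0 : (0 : ℝ) < 1 - δ := by linarith
  have hσ1 : (1 : ℝ) - δ < 1 := by linarith
  rcases le_or_gt 1 (starkK (A : ℝ) (B : ℝ) (C : ℝ)) with h1 | h1
  · -- `k ≥ 1`: transfer to `Λ_{z'}` with `Im z' = k`, then the sharp bound with `2k ≤ √d`
    obtain ⟨z, hre, him, hk'⟩ := exists_zQ' hpos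
    have hZ' : IsEpsteinContinuation (C : ℝ) (B : ℝ) (A : ℝ) Z :=
      (isEpsteinContinuation_swap_iff (A : ℝ) (B : ℝ) (C : ℝ) Z).2 hZ
    rw [continuation_ofReal_eq hpos.swap z hre him hZ' hσ0 hσ1, Complex.re_ofReal_mul]
    refine mul_neg_of_pos_of_neg (realFactor_pos hpos.swap hσ0) ?_
    rw [← hk'] at h1
    have hlt := re_thetaΛ_lt_of_one_le_im z h1 hδ0 hδ1
    -- `2 Im z = √d/A ≤ √d`
    have h2k : 2 * z.im ≤ Real.sqrt d := by
      rw [hk', hk]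
      rw [show 2 * (Real.sqrt d / (2 * A)) = Real.sqrt d / A by field_simp]
      exact div_le_self hsd0.le haR
    have hpi : 0 < Real.pi / 6 + 2.6 * δ := by linarith [Real.pi_gt_three]
    have := mul_le_mul_of_nonneg_right h2k hpi.le
    linarith
  · exact re_neg_of_starkK_le_one hpos hk45 h1.le hZ hσ0 hσ1

/-- **`Re L(σ, χ) > 0` on `[1 − c/√d, 1)` for every admissible `c`** (`χ` odd real primitive mod `d > 4`):
if `0 < c`, `10c ≤ √d` and `√d·(π/6) + 2.6c ≤ √d/c + 0.92` (i.e. `√d(1/c − π/6) ≥ 2.6c − 0.92`; any `c < 6/π`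
works for `d ≥ d₀(c)`), then `Re L(σ, χ) > 0` for `1 − c/√d ≤ σ < 1`. Class-isolated sign argument as in
`LFunction_re_pos_of_odd_quadratic` (tree), with the sharp per-class lemma.
[cite: GoldfeldSchinzel1975, Corollary p. 572 (case d < 0)] [cite: MontgomeryVaughan2007, Corollary 11.12 and §11.5 notes] -/
theorem LFunction_re_pos_of_odd_quadratic_sharp {d : ℕ} [NeZero d] (hd : 4 < d)
    {χ : DirichletCharacter ℂ d} (hprim : χ.IsPrimitive) (hquad : χ.IsQuadratic) (hodd : χ.Odd)
    {c₀ : ℝ} (hc0 : 0 < c₀) (h10 : 10 * c₀ ≤ Real.sqrt d)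
    (hc : Real.sqrt d * (Real.pi / 6) + 2.6 * c₀ ≤ Real.sqrt d / c₀ + 0.92)
    {σ : ℝ} (hσ : 1 - c₀ / Real.sqrt d ≤ σ) (hσ1 : σ < 1) : 0 < (χ.LFunction σ).re := by
  classical
  have hd4R : (4 : ℝ) < d := by exact_mod_cast hd
  have hsd : 2 ≤ Real.sqrt d := (Real.le_sqrt' two_pos).2 (by linarith)
  have hsd0 : 0 < Real.sqrt d := by linarith
  -- `δ = 1 − σ ∈ (0, c₀/√d] ⊂ (0, 1/10]` and the class condition at `δ`
  set δ : ℝ := 1 - σ with hδdef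
  have hδ0 : 0 < δ := by rw [hδdef]; linarith
  have hδc : δ ≤ c₀ / Real.sqrt d := by rw [hδdef]; linarith
  have hcd : c₀ / Real.sqrt d ≤ 1 / 10 := by
    rw [div_le_div_iff₀ hsd0 (by norm_num)]; linarith
  have hδ1 : δ ≤ 1 / 10 := hδc.trans hcd
  have hX : Real.sqrt d * (Real.pi / 6 + 2.6 * δ) ≤ 1 / δ + 0.92 := by
    have h1 : Real.sqrt d * (Real.pi / 6 + 2.6 * δ) ≤ Real.sqrt d * (Real.pi / 6 + 2.6 * (c₀ / Real.sqrt d)) := by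
      apply mul_le_mul_of_nonneg_left _ hsd0.le; linarith
    have h2 : Real.sqrt d * (Real.pi / 6 + 2.6 * (c₀ / Real.sqrt d)) = Real.sqrt d * (Real.pi / 6) + 2.6 * c₀ := by
      field_simp
    have h3 : Real.sqrt d / c₀ ≤ 1 / δ := by
      rw [div_le_div_iff₀ hc0 hδ0]
      have := mul_le_mul_of_nonneg_left hδc hsd0.le
      rw [mul_div_cancel₀ _ hsd0.ne'] at this
      linarith
    linarith
  have hσ0 : 0 < σ := by linarith
  have hσeq : ((1 - δ : ℝ) : ℂ) = (σ : ℂ) := by rw [hδdef]; push_cast; ring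
  have hχ1 : χ ≠ 1 := by
    intro h
    have h1 : χ (-1) = -1 := hodd
    rw [h, MulChar.one_apply (isUnit_one.neg)] at h1
    norm_num at h1
  set S := reducedForms (-(d : ℤ)) with hS
  -- continuations of the class zeta functions
  have hex : ∀ Q : ℤ × ℤ × ℤ, ∃ Z : ℂ → ℂ,
      Q ∈ S → IsEpsteinContinuation (Q.1 : ℝ) (Q.2.1 : ℝ) (Q.2.2 : ℝ) Z := by
    intro Q
    by_cases hQ : Q ∈ S
    · have hD0 : (-(d : ℤ)) < 0 := by omega
      obtain ⟨hdisc, ha, -, hred⟩ := (mem_reducedForms_iff hD0).1 hQ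
      obtain ⟨-, hb1, hb2, hac⟩ := le_of_isReduced (a := Q.1) (b := Q.2.1) (c := Q.2.2) hdisc ha hred
      rw [show Q = (Q.1, Q.2.1, Q.2.2) from rfl, discr_apply] at hdisc
      have hpos : IsPosDefForm (Q.1 : ℝ) (Q.2.1 : ℝ) (Q.2.2 : ℝ) := by
        refine ⟨by exact_mod_cast ha, ?_⟩
        have : (Q.2.1 : ℝ) ^ 2 - 4 * (Q.1 : ℝ) * (Q.2.2 : ℝ) = ((-(d : ℤ) : ℤ) : ℝ) := by
          exact_mod_cast hdisc
        rw [this]; push_cast; linarith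
      obtain ⟨Z, hZ, -⟩ := MontgomeryVaughan2007_epsteinContinuation_holds _ _ _ hpos
      exact ⟨Z, fun _ => hZ⟩
    · exact ⟨0, fun h => absurd h hQ⟩
  choose Z hZ using hex
  set G : ℂ → ℂ := fun s => 1 / 2 * ∑ Q ∈ S, Z Q s with hGdef
  set F : ℂ → ℂ := fun s => riemannZeta s * χ.LFunction s with hFdef
  have hU : IsOpen {s : ℂ | s ≠ 1} := isOpen_ne
  have hFd : DifferentiableOn ℂ F {s : ℂ | s ≠ 1} := fun s hs =>
    ((differentiableAt_riemannZeta hs).mul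
      ((DirichletCharacter.differentiable_LFunction hχ1) s)).differentiableWithinAt
  have hGd : DifferentiableOn ℂ G {s : ℂ | s ≠ 1} :=
    (differentiableOn_const _).mul (DifferentiableOn.fun_sum fun Q hQ => (hZ Q hQ).1)
  have hFG : EqOn F G {s : ℂ | s ≠ 1} := by
    refine (hFd.analyticOnNhd hU).eqOn_of_preconnected_of_eventuallyEq (hGd.analyticOnNhd hU)
      isPreconnected_compl_one (show (2 : ℂ) ∈ {s : ℂ | s ≠ 1} by norm_num) ?_
    have hopen : IsOpen {s : ℂ | 1 < s.re} := isOpen_lt continuous_const Complex.continuous_re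
    filter_upwards [hopen.mem_nhds (show (2 : ℂ) ∈ {s : ℂ | 1 < s.re} by simp)] with s hs
    have hs' : 1 < s.re := hs
    simp only [hFdef, hGdef]
    rw [riemannZeta_mul_LFunction_eq_half_sum_of_one_lt_re hd hprim hquad hodd hs']
    congr 1
    exact Finset.sum_congr rfl fun Q hQ => ((hZ Q hQ).2 s hs').symm
  -- the class sum is non-empty (else `ζ(2)L(2, χ) = 0`)
  have hne : S.Nonempty := by
    by_contra hS0
    rw [Finset.not_nonempty_iff_eq_empty] at hS0
    have h2 := hFG (show (2 : ℂ) ∈ {s : ℂ | s ≠ 1} by norm_num)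
    simp only [hFdef, hGdef, hS0, Finset.sum_empty, mul_zero] at h2
    exact mul_ne_zero (riemannZeta_ne_zero_of_one_lt_re (by norm_num))
      (χ.LFunction_ne_zero_of_one_le_re (Or.inl hχ1) (by norm_num)) h2
  -- at the real point `σ`
  have hσU : ((σ : ℂ)) ∈ {s : ℂ | s ≠ 1} := by
    simp only [Set.mem_setOf_eq]
    exact_mod_cast hσ1.ne
  have heq := hFG hσU
  simp only [hFdef, hGdef] at heq
  have hGneg : (1 / 2 * ∑ Q ∈ S, Z Q σ).re < 0 := by
    rw [show (1 : ℂ) / 2 = ((1 / 2 : ℝ) : ℂ) by push_cast; ring, Complex.re_ofReal_mul, Complex.re_sum]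
    have hlt : ∑ Q ∈ S, (Z Q σ).re < ∑ _Q ∈ S, (0 : ℝ) :=
      Finset.sum_lt_sum_of_nonempty hne fun Q hQ => by
        have h := re_neg_of_mem_reducedForms_sharp hd (A := Q.1) (B := Q.2.1) (C := Q.2.2) hQ (hZ Q hQ)
          hδ0 hδ1 hX
        rwa [hσeq] at h
    rw [Finset.sum_const_zero] at hlt
    linarith
  rw [← heq, Complex.mul_re, riemannZeta_im_eq_zero_of_pos hσ0 hσ1.ne, zero_mul, sub_zero] at hGneg
  exact pos_of_mul_neg_right hGneg (riemannZeta_re_neg_of_pos_of_lt_one hσ0 hσ1).le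

/-- **No real zero of `L(s, χ)` in `[1 − c/√d, 1)`** under the same conditions.
[cite: GoldfeldSchinzel1975, Corollary p. 572 (case d < 0)] -/
theorem LFunction_ne_zero_of_odd_quadratic_sharp {d : ℕ} [NeZero d] (hd : 4 < d)
    {χ : DirichletCharacter ℂ d} (hprim : χ.IsPrimitive) (hquad : χ.IsQuadratic) (hodd : χ.Odd)
    {c₀ : ℝ} (hc0 : 0 < c₀) (h10 : 10 * c₀ ≤ Real.sqrt d)
    (hc : Real.sqrt d * (Real.pi / 6) + 2.6 * c₀ ≤ Real.sqrt d / c₀ + 0.92)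
    {σ : ℝ} (hσ : 1 - c₀ / Real.sqrt d ≤ σ) (hσ1 : σ < 1) : χ.LFunction σ ≠ 0 := by
  intro h0
  have h := LFunction_re_pos_of_odd_quadratic_sharp hd hprim hquad hodd hc0 h10 hc hσ hσ1
  rw [h0, Complex.zero_re] at h
  exact lt_irrefl _ h

/-! ### Numeric instances: `1.5/√d` for `d ≥ 441`, `1.9/√d` for `d ≥ 2.2·10⁶` -/

/-- **`1 − β > 1.5/√d`** for every real zero `β < 1` of `L(s, χ)`, every odd real primitive `χ` mod `d ≥ 441`
(`c = 3/2`: `√d(2/3 − π/6) ≥ 21·0.14306 = 3.004 > 2.98 = 2.6·1.5 − 0.92`). [cite: GoldfeldSchinzel1975, Corollary p. 572 (case d < 0)] -/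
theorem one_sub_realZero_gt_three_halves_of_odd {d : ℕ} [NeZero d] (hd : 441 ≤ d)
    {χ : DirichletCharacter ℂ d} (hprim : χ.IsPrimitive) (hquad : χ.IsQuadratic) (hodd : χ.Odd)
    {β : ℝ} (hβ1 : β < 1) (hz : χ.LFunction β = 0) : 1.5 / Real.sqrt d < 1 - β := by
  have hdR : (441 : ℝ) ≤ d := by exact_mod_cast hd
  have hsd : 21 ≤ Real.sqrt d := by
    rw [show (21 : ℝ) = Real.sqrt (21 ^ 2) by rw [Real.sqrt_sq (by norm_num)]]
    exact Real.sqrt_le_sqrt (by linarith)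
  have hpi := Real.pi_lt_d6
  by_contra hcon
  push Not at hcon
  refine LFunction_ne_zero_of_odd_quadratic_sharp (by omega) hprim hquad hodd (c₀ := 1.5) (by norm_num)
    (by linarith) ?_ (by linarith) hβ1 hz
  rw [show Real.sqrt d / 1.5 = Real.sqrt d * (2 / 3) by ring]
  nlinarith

/-- **`1 − β > 1.9/√d`** for every real zero `β < 1` of `L(s, χ)`, every odd real primitive `χ` mod
`d ≥ 2 200 000` (`c = 1.9`: `√d(1/1.9 − π/6) ≥ 1483·0.002717 = 4.029 > 4.02 = 2.6·1.9 − 0.92`).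
[cite: GoldfeldSchinzel1975, Corollary p. 572 (case d < 0)] -/
theorem one_sub_realZero_gt_of_odd_of_ge {d : ℕ} [NeZero d] (hd : 2200000 ≤ d)
    {χ : DirichletCharacter ℂ d} (hprim : χ.IsPrimitive) (hquad : χ.IsQuadratic) (hodd : χ.Odd)
    {β : ℝ} (hβ1 : β < 1) (hz : χ.LFunction β = 0) : 1.9 / Real.sqrt d < 1 - β := by
  have hdR : (2200000 : ℝ) ≤ d := by exact_mod_cast hd
  have hsd : 1483 ≤ Real.sqrt d := by
    rw [show (1483 : ℝ) = Real.sqrt (1483 ^ 2) by rw [Real.sqrt_sq (by norm_num)]]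
    exact Real.sqrt_le_sqrt (by linarith)
  have hpi := Real.pi_lt_d6
  by_contra hcon
  push Not at hcon
  refine LFunction_ne_zero_of_odd_quadratic_sharp (by omega) hprim hquad hodd (c₀ := 1.9) (by norm_num)
    (by linarith) ?_ (by linarith) hβ1 hz
  rw [show Real.sqrt d / 1.9 = Real.sqrt d * (10 / 19) by ring]
  nlinarith

/-- **The quality of a Tao–Teräväinen Siegel zero at an ODD character: `η < √d/(1.5 log d)`** (`d ≥ 441`;
`β₀ = 1 − 1/(η log d)` is a real zero, so `1/(η log d) > 1.5/√d`). [cite: TaoTeravainen2021, Definition 1.4]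
[cite: GoldfeldSchinzel1975, Corollary p. 572 (case d < 0)] -/
theorem isSiegelZero_quality_lt_of_odd {d : ℕ} [NeZero d] (hd : 441 ≤ d)
    {χ : DirichletCharacter ℂ d} {η : ℝ} (hS : IsSiegelZero χ η) (hodd : χ.Odd) :
    η < Real.sqrt d / (1.5 * Real.log d) := by
  obtain ⟨hprim, hquad, h10, hzero⟩ := hS
  have hdR : (441 : ℝ) ≤ d := by exact_mod_cast hd
  have hlog : 0 < Real.log d := Real.log_pos (by linarith)
  have hη0 : 0 < η := by linarith
  have hβ1 : 1 - 1 / (η * Real.log d) < 1 := by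
    have : 0 < 1 / (η * Real.log d) := by positivity
    linarith
  have h := one_sub_realZero_gt_three_halves_of_odd hd hprim hquad hodd hβ1 (by exact_mod_cast hzero)
  rw [show (1 : ℝ) - (1 - 1 / (η * Real.log d)) = 1 / (η * Real.log d) by ring] at h
  have hsd0 : 0 < Real.sqrt d := Real.sqrt_pos.2 (by linarith)
  rw [div_lt_div_iff₀ hsd0 (by positivity)] at h
  rw [lt_div_iff₀ (by positivity)]
  linarith

/-! ### Goldfeld–Schinzel's Corollary, case `d < 0`, AS PRINTED — proved -/

/-- **Goldfeld–Schinzel 1975, Corollary (case `d < 0`), our proof:** "For any `η > 0` and `|d| > c(η)` (`d`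
fundamental) we have `1 − β ≥ (6/π − η)/√|d|` if `d < 0` […] where `c(η)` is an effectively computable
constant" — here for every odd real primitive `χ` mod `d` (`d = |d_K|` of the imaginary quadratic field) and
EVERY real `β` with `L(β, χ) = 0` (zeros `β < 1 − c/√d` and the trivial zeros satisfy it outright; `β ≥ 1` is
impossible), with `c(η)` explicit from `LFunction_ne_zero_of_odd_quadratic_sharp` at `c = 6/π − η`. The even half
(`(6/π² − η) log d/√d`) of the typed named fact `goldfeldSchinzel1975_corollary` is not reached by this method.
[cite: GoldfeldSchinzel1975, Corollary p. 572 (case d < 0)] -/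
theorem goldfeldSchinzel1975_corollary_odd :
    ∀ η : ℝ, 0 < η → ∃ N : ℕ, ∀ (d : ℕ) [NeZero d], N < d →
      ∀ χ : DirichletCharacter ℂ d, χ.IsQuadratic → χ.IsPrimitive → χ.Odd →
        ∀ β : ℝ, χ.LFunction (β : ℂ) = 0 → (6 / Real.pi - η) / Real.sqrt d ≤ 1 - β := by
  intro η hη
  have hpi3 := Real.pi_gt_three
  have hpi0 := Real.pi_pos
  by_cases hc : 6 / Real.pi - η ≤ 0
  · -- trivial: the bound is `≤ 0 < 1 − β`
    refine ⟨4, fun d _ hd χ hquad hprim hodd β hz => ?_⟩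
    have hχ1 : χ ≠ 1 := by
      intro h
      have h1 : χ (-1) = -1 := hodd
      rw [h, MulChar.one_apply (isUnit_one.neg)] at h1
      norm_num at h1
    have hβ1 : β < 1 := by
      by_contra hcon
      push Not at hcon
      exact DirichletCharacter.LFunction_ne_zero_of_one_le_re χ (Or.inl hχ1) (by simp; exact hcon) hz
    have : (6 / Real.pi - η) / Real.sqrt d ≤ 0 := div_nonpos_of_nonpos_of_nonneg hc (Real.sqrt_nonneg _)
    linarith
  push Not at hc
  set c₀ : ℝ := 6 / Real.pi - η with hc₀
  have hc0 : 0 < c₀ := hc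
  -- `1/c₀ − π/6 > 0`
  have hgap : 0 < 1 / c₀ - Real.pi / 6 := by
    have : c₀ < 6 / Real.pi := by rw [hc₀]; linarith
    have h1 : Real.pi / 6 = 1 / (6 / Real.pi) := by field_simp
    rw [h1, sub_pos]
    exact one_div_lt_one_div_of_lt hc0 this
  -- threshold: `√d ≥ T := max (10 c₀) ((2.6 c₀) / (1/c₀ − π/6)) + 2`, i.e. `d > T²`
  set T : ℝ := max (10 * c₀) (2.6 * c₀ / (1 / c₀ - Real.pi / 6)) + 2 with hT
  have hT2 : 2 ≤ T := by
    rw [hT]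
    have : 0 ≤ max (10 * c₀) (2.6 * c₀ / (1 / c₀ - Real.pi / 6)) := le_trans (by positivity) (le_max_left _ _)
    linarith
  refine ⟨⌈T ^ 2⌉₊ + 4, fun d _ hd χ hquad hprim hodd β hz => ?_⟩
  have hd4 : 4 < d := by omega
  have hdR : T ^ 2 ≤ (d : ℝ) := by
    have h1 : (⌈T ^ 2⌉₊ : ℝ) < d := by
      have : (⌈T ^ 2⌉₊ + 4 : ℕ) < d := hd
      exact_mod_cast (by omega : ⌈T ^ 2⌉₊ < d)
    exact le_trans (Nat.le_ceil _) h1.le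
  have hsd : T ≤ Real.sqrt d := by
    rw [show T = Real.sqrt (T ^ 2) by rw [Real.sqrt_sq (by linarith)]]
    exact Real.sqrt_le_sqrt hdR
  have hsd0 : 0 < Real.sqrt d := by linarith
  have h10 : 10 * c₀ ≤ Real.sqrt d := by
    have := le_max_left (10 * c₀) (2.6 * c₀ / (1 / c₀ - Real.pi / 6)); rw [hT] at hsd; linarith
  have hcc : Real.sqrt d * (Real.pi / 6) + 2.6 * c₀ ≤ Real.sqrt d / c₀ + 0.92 := by
    have hm : 2.6 * c₀ / (1 / c₀ - Real.pi / 6) ≤ Real.sqrt d := by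
      have := le_max_right (10 * c₀) (2.6 * c₀ / (1 / c₀ - Real.pi / 6)); rw [hT] at hsd; linarith
    rw [div_le_iff₀ hgap] at hm
    have e : Real.sqrt d / c₀ = Real.sqrt d * (1 / c₀) := by ring
    rw [e]
    nlinarith
  have hχ1 : χ ≠ 1 := by
    intro h
    have h1 : χ (-1) = -1 := hodd
    rw [h, MulChar.one_apply (isUnit_one.neg)] at h1
    norm_num at h1
  have hβ1 : β < 1 := by
    by_contra hcon
    push Not at hcon
    exact DirichletCharacter.LFunction_ne_zero_of_one_le_re χ (Or.inl hχ1) (by simp; exact hcon) hz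
  by_contra hcon
  push Not at hcon
  -- then `β ∈ [1 − c₀/√d, 1)`: excluded
  exact LFunction_ne_zero_of_odd_quadratic_sharp hd4 hprim hquad hodd hc0 h10 hcc (by linarith) hβ1 hz

end ClassSumRepulsion

end Literature.NumberTheory.LFunctions

end
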